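import Summits.PneNP.GCT.Max.KYPaddedPerFourSixRows
import Summits.PneNP.GCT.Max.KYSharperEveryM
import HarnessLib
import HarnessLib.Audit

/-!
# `GCT/Max`: `m = 4` — plain Koszul–Young flattenings cannot separate `X₀₀^{n-4}·per₄` from `det_n` for any `n ≥ 6`
# (cell `pub-gct-max`, track F; theory-2 memo `FINDINGS-LT2.md` §3, W2b)

`Max/KYSharperEveryM.lean` (`KYCannotSeparatePaddedPerSharperEveryM`, `3m+2 ≤ 2n`) gives the `m = 4` statement for `n ≥ 7` by the ONE-FAMILY
leading-term count `LT`.  At `(m, n) = (4, 6)` that count fails at exactly two of the `3·36` primal cells `(c, k)` (`c = n²-1-p`,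
`2k+1 ≤ n`): `(8, 1)` and `(9, 1)` (targets `min(S(4,k)·C(36,c+1), S(4,k+1)·C(36,c))` = `1 600 435 760` and `4 321 176 552` against
`LT(6,8,1) = 1 497 852 741` and `LT(6,9,1) = 4 196 758 755`), and the ORDER-OPTIMISED two-witness count `LT2_σ` of `Max/DetKYLeadingTermsTwo.lean`
closes both in row-major order `σ = 1`: `LT2₁(6,27,1) = 2 078 468 225` and `LT2₁(6,26,1) = 5 816 179 945` (theory-2 numerics `calc35-lt2`, reproduced
and the lower bounds proved here IN THE KERNEL).  `lt2IEFast 6 p 1 σ` is the sum of its fifteen row terms `rowF 6 p 1 σ I'` (`I'` a 2-subset of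
`Fin 6`; list form `lt2IEFast 6 p 1 σ = (pairs6.map (rowF 6 p 1 σ)).sum`), and EVERY row term is `≥ 0` — it is a sum of cardinalities of
achievable-label sets by the inclusion–exclusion identity `card_achT_eq` of `Max/DetKYLeadingTermsTwoCount` (`rowF_eq_sum_card`, `rowF_nonneg`) —
so the five largest rows (`I' ∋ 5`) already give `LT2₁(6,27,1) ≥ 1 651 071 634` (`Max/KYPaddedPerFourSixRows.lean`: the row machinery and the
`p = 27` cell) and `LT2₁(6,26,1) ≥ 4 837 470 166` (here), above both targets: ten kernel row evaluations (`decide +kernel`, ≈ 15–40 s each on the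
farm; one declaration per row keeps each evaluation inside the default budget, five rows per file keep each file inside the per-file budget)
instead of thirty.

Contents: `KYCellsLT2.kyRank_le_of_detBounds` (the generic cell assembly of `Max/KYSharperEveryM` with an ABSTRACT determinant-side bound per
primal cell — so one-family cells (`kCell`, `detBound_of_kCell`) and `LT2` cells (`detBound_of_lt2`, via `Max/DetKYLeadingTermsTwoFast`'s `le_kyRank_detPoly_of_le_lt2IEFast`) mix);
the `p = 26` rows and cell bound (`cell_6_26`; `cell_6_27` and the row machinery `rowF`, `rowF_nonneg`, `pairs6`, `lt2IEFast_six_one`,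
`sum_ge_of_five` are imported from `Max/KYPaddedPerFourSixRows`); the `(4,6)` table
(`table_4_6`: every other primal cell passes `kCell`); the node `KYCannotSeparatePaddedPerFourFromSix` and `_holds` (`n = 6` here, `n ≥ 7` from
`kyCannotSeparatePaddedPerSharperEveryM_holds`).  What remains open for `m = 4` inside Lean is the single size `n = 5` (34 failing cells incl.
`k = 2`; certified numerically by `LT2` in the diagonal-sweep order, memo §3 — successor work), i.e. the `m = 4` analogue of N-F-1 from `n ≥ 5`.

HONEST FRAMING: a LOCATED NEGATIVE about ONE family of equations (plain Koszul–Young flattenings `Λ^p ⊗ S^k`) for the padded `4 × 4`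
permanent: the instrument is blind at every `n ≥ 6`, in particular at `n = 6, 7` where separation is KNOWN to hold in print
([LandsbergManivelRessayre2013] Thm. 1.0.1: `\underline{dc}(per_m) ≥ m²/2 = 8`, so `X₀₀^{n-4}·per₄ ∉ \overline{GL_{n²}·det_n}` for `n ≤ 7`).  It says
nothing about other Young flattenings, border apolarity or multiplicity obstructions, and nothing about `dc(per₄)`, VP vs VNP or P vs NP;
occurrence obstructions are ruled out in print (BIP'16).  References: [LandsbergGCT2017] §8.2.1; [EfremenkoLandsbergSchenckWeyman2018] §1.1.
Mathematics and numerics: theory-2 gen 27 (memo FINDINGS-LT2). [folklore]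
-/

noncomputable section

namespace Summit.PneNP.GCT

open Literature.Computability.AlgebraicComplexity Literature.Barriers.ValiantsHypothesis

namespace KYCellsLT2

open Finset DetKYLeadingTerms DetKYLeadingTermsTwo KYAllM KYKOneExact

/-! ## Generic assembly with an abstract determinant-side bound per primal cell -/

/-- If `min(S(m,k)·C(n²,c+1), S(m,k+1)·C(n²,c)) ≤ rank KY_{n²-1-c,k}(det_n)` at every primal cell (`2k+1 ≤ n`, `c+1 ≤ n²`), then
`rank KY_{p,k}(X₀₀^{n-m}·per_m) ≤ rank KY_{p,k}(det_n)` at every `(p,k)` (`m ≤ n`); the dual cells go through the transpose duality of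
`det_n` (`DetKYLeadingTerms.kyRank_detPoly_dual`).  Same proof as `KYCells.kyRank_le_of_cells`. [folklore] -/
theorem kyRank_le_of_detBounds (m n : ℕ) [NeZero n] (hmn : m ≤ n)
    (hcell : ∀ c k : ℕ, 2 * k + 1 ≤ n → c + 1 ≤ n * n →
      min (chooseSqSum m k * (n * n).choose (c + 1)) (chooseSqSum m (k + 1) * (n * n).choose c) ≤
        kyRank ℂ (n * n - 1 - c) k (detPoly (Fin n) ℂ))
    (p k : ℕ) : kyRank ℂ p k (paddedPerPoly ℂ m n) ≤ kyRank ℂ p k (detPoly (Fin n) ℂ) := by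
  obtain ⟨hlow, hhigh, hz⟩ := paddedPerKYUpperBounds_holds m n p k hmn
  rcases Nat.lt_or_ge k n with hk | hk
  swap
  · rw [hz hk]; exact Nat.zero_le _
  rcases Nat.lt_or_ge p (n * n) with hp | hp
  swap
  · have h0 : (∑ i ∈ range (k + 1 + 1), (m.choose i) ^ 2) * (n * n).choose (p + 1) = 0 := by
      rw [Nat.choose_eq_zero_of_lt (by omega : n * n < p + 1), Nat.mul_zero]
    have h := hlow.trans (min_le_right _ _)
    rw [h0] at h
    exact h.trans (Nat.zero_le _)
  have hpN : p + 1 ≤ n * n := hp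
  have hkn : k + 1 ≤ n := hk
  by_cases hks : 2 * k + 1 ≤ n
  · have hc : n * n - 1 - p + 1 ≤ n * n := by omega
    have h1 : kyRank ℂ p k (paddedPerPoly ℂ m n) ≤
        min (chooseSqSum m k * (n * n).choose (n * n - 1 - p + 1)) (chooseSqSum m (k + 1) * (n * n).choose (n * n - 1 - p)) := by
      rw [show n * n - 1 - p + 1 = n * n - p by omega, Nat.choose_symm (Nat.le_of_succ_le hpN),
        show n * n - 1 - p = n * n - (p + 1) by omega, Nat.choose_symm hpN, KYSharper.chooseSqSum_eq, KYSharper.chooseSqSum_eq]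
      exact hlow
    have h2 := hcell (n * n - 1 - p) k hks hc
    rw [show n * n - 1 - (n * n - 1 - p) = p by omega] at h2
    exact h1.trans h2
  · have hks' : 2 * (n - 1 - k) + 1 ≤ n := by omega
    have h1 : kyRank ℂ p k (paddedPerPoly ℂ m n) ≤
        min (chooseSqSum m (n - 1 - k) * (n * n).choose (p + 1)) (chooseSqSum m (n - 1 - k + 1) * (n * n).choose p) := by
      rw [min_comm, show n - 1 - k + 1 = n - k by omega, KYSharper.chooseSqSum_eq, KYSharper.chooseSqSum_eq, show n - 1 - k = n - (k + 1) by omega]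
      exact hhigh
    rw [kyRank_detPoly_dual ℂ n p k hpN hkn]
    exact h1.trans (hcell p (n - 1 - k) hks' hpN)

/-- A one-family cell: `kCell m n c k = true` gives the determinant-side bound through `LT(n,c,k) ≤ rank KY_{n²-1-c,k}(det_n)`
(`DetKYLeadingTermBound`). [folklore] -/
theorem detBound_of_kCell (m n c k : ℕ) (hk : 2 * k + 1 ≤ n) (hc : c + 1 ≤ n * n) (h : kCell m n c k = true) :
    min (chooseSqSum m k * (n * n).choose (c + 1)) (chooseSqSum m (k + 1) * (n * n).choose c) ≤
      kyRank ℂ (n * n - 1 - c) k (detPoly (Fin n) ℂ) := by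
  refine (kCell_sound m n c k h).trans ?_
  have h' := detKYLeadingTermBound_holds n (n * n - 1 - c) k (by omega) (by omega)
  rw [show n * n - 1 - (n * n - 1 - c) = c by omega] at h'
  exact (le_max_left _ _).trans h'

/-- An `LT2` cell: a kernel value of `lt2IEFast n (n²-1-c) k σ` above the target gives the determinant-side bound
(`le_kyRank_detPoly_of_le_lt2IEFast`). [folklore] -/
theorem detBound_of_lt2 (m n c k : ℕ) (σ : Equiv.Perm (Fin (n * n))) (hc : c + 1 ≤ n * n)
    (h : ((min (chooseSqSum m k * (n * n).choose (c + 1)) (chooseSqSum m (k + 1) * (n * n).choose c) : ℕ) : ℤ) ≤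
      lt2IEFast n (n * n - 1 - c) k σ) :
    min (chooseSqSum m k * (n * n).choose (c + 1)) (chooseSqSum m (k + 1) * (n * n).choose c) ≤
      kyRank ℂ (n * n - 1 - c) k (detPoly (Fin n) ℂ) :=
  le_kyRank_detPoly_of_le_lt2IEFast ℂ (by omega) _ h

/-! ## The cell `(c,k) = (9,1)` (`p = 26`) at `n = 6`: the five heavy rows (row-major `σ = 1`) -/

/-- Row `I' = {0,5}` of `LT2₁(6,26,1)`. [folklore] -/ theorem r26_05 : rowF 6 26 1 1 {0, 5} = 893130118 := by decide +kernel
/-- Row `I' = {1,5}` of `LT2₁(6,26,1)`. [folklore] -/ theorem r26_15 : rowF 6 26 1 1 {1, 5} = 894141243 := by decide +kernel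
/-- Row `I' = {2,5}` of `LT2₁(6,26,1)`. [folklore] -/ theorem r26_25 : rowF 6 26 1 1 {2, 5} = 904998162 := by decide +kernel
/-- Row `I' = {3,5}` of `LT2₁(6,26,1)`. [folklore] -/ theorem r26_35 : rowF 6 26 1 1 {3, 5} = 964787541 := by decide +kernel
/-- Row `I' = {4,5}` of `LT2₁(6,26,1)`. [folklore] -/ theorem r26_45 : rowF 6 26 1 1 {4, 5} = 1180413102 := by decide +kernel

/-- `LT2₁(6,26,1) ≥ 4 837 470 166` = the five heavy rows (the full value is `5 816 179 945`). [folklore] -/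
theorem cell_6_26 : (4837470166 : ℤ) ≤ lt2IEFast 6 26 1 1 := by
  have h5 := sum_ge_of_five (rowF_nonneg (n := 6) (p := 26) 1 1 (by norm_num))
  rw [r26_05, r26_15, r26_25, r26_35, r26_45, ← lt2IEFast_six_one] at h5
  exact le_trans (by norm_num) h5

/-- Target of the cell `(8,1)`: `min(17·C(36,9), 53·C(36,8)) = 1 600 435 760 ≤ 1 651 071 634` (fast mirrors `chooseSqSumD`, `binomD`). [folklore] -/
theorem target_6_8 :
    ((min (chooseSqSum 4 1 * (6 * 6).choose (8 + 1)) (chooseSqSum 4 (1 + 1) * (6 * 6).choose 8) : ℕ) : ℤ) ≤ 1651071634 := by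
  rw [← chooseSqSumD_eq, ← chooseSqSumD_eq, ← binomD_eq, ← binomD_eq]; decide +kernel

/-- Target of the cell `(9,1)`: `min(17·C(36,10), 53·C(36,9)) = 4 321 176 552 ≤ 4 837 470 166`. [folklore] -/
theorem target_6_9 :
    ((min (chooseSqSum 4 1 * (6 * 6).choose (9 + 1)) (chooseSqSum 4 (1 + 1) * (6 * 6).choose 9) : ℕ) : ℤ) ≤ 4837470166 := by
  rw [← chooseSqSumD_eq, ← chooseSqSumD_eq, ← binomD_eq, ← binomD_eq]; decide +kernel

/-! ## The `(4,6)` table and assembly -/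

/-- At `(m,n) = (4,6)` every primal cell passes the one-family test `kCell` except `(8,1)` and `(9,1)` (kernel, brute-force mirror). [folklore] -/
theorem table_4_6 : ∀ k, k ≤ 2 → ∀ c, c ≤ 35 → kCell 4 6 c k = true ∨ (k = 1 ∧ (c = 8 ∨ c = 9)) := by decide +kernel

/-- Every primal cell at `(4,6)` has its determinant-side bound. [folklore] -/
theorem cells_4_6 (c k : ℕ) (hk : 2 * k + 1 ≤ 6) (hc : c + 1 ≤ 6 * 6) :
    min (chooseSqSum 4 k * (6 * 6).choose (c + 1)) (chooseSqSum 4 (k + 1) * (6 * 6).choose c) ≤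
      kyRank ℂ (6 * 6 - 1 - c) k (detPoly (Fin 6) ℂ) := by
  rcases table_4_6 k (by omega) c (by omega) with h | ⟨rfl, rfl | rfl⟩
  · exact detBound_of_kCell 4 6 c k hk hc h
  · refine detBound_of_lt2 4 6 8 1 1 hc ?_
    rw [show 6 * 6 - 1 - 8 = 27 from rfl]; exact target_6_8.trans cell_6_27
  · refine detBound_of_lt2 4 6 9 1 1 hc ?_
    rw [show 6 * 6 - 1 - 9 = 26 from rfl]; exact target_6_9.trans cell_6_26

/-- `m = 4`, `n = 6`: no plain Koszul–Young flattening separates `X₀₀²·per₄` from `det₆`. [folklore] -/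
theorem kyRank_paddedPerFour_le_detSix (p k : ℕ) :
    kyRank ℂ p k (paddedPerPoly ℂ 4 6) ≤ kyRank ℂ p k (detPoly (Fin 6) ℂ) :=
  kyRank_le_of_detBounds 4 6 (by norm_num) cells_4_6 p k

end KYCellsLT2

/-- `GCT/Max` node **KYCannotSeparatePaddedPerFourFromSix** (`m = 4` analogue of N-F-1 from `n = 6`): for every `n ≥ 6` and every
`(p,k)`, `rank KY_{p,k}(X₀₀^{n-4}·per₄) ≤ rank KY_{p,k}(det_n)` over `ℂ` — plain Koszul–Young flattenings are silent on the padded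
`4 × 4` permanent at every `n ≥ 6`, in particular at `n = 6, 7` where `X₀₀^{n-4}·per₄ ∉ \overline{GL·det_n}` is known
([LandsbergManivelRessayre2013]).  A statement of the cell (LOCATED NEGATIVE on one instrument), PROVED below; `n = 5` is open in Lean. [folklore] -/
def KYCannotSeparatePaddedPerFourFromSix : Prop :=
  ∀ (n : ℕ) [NeZero n], 6 ≤ n → ∀ p k : ℕ, kyRank ℂ p k (paddedPerPoly ℂ 4 n) ≤ kyRank ℂ p k (detPoly (Fin n) ℂ)

/-- `KYCannotSeparatePaddedPerFourFromSix` holds: `n = 6` by the table above (two `LT2` cells), `n ≥ 7` by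
`KYCannotSeparatePaddedPerSharperEveryM` (`3·4+2 ≤ 2n`, its corollary `kyRank_paddedPerPoly_four_le`). [folklore] -/
theorem kyCannotSeparatePaddedPerFourFromSix_holds : KYCannotSeparatePaddedPerFourFromSix := by
  intro n _ hn p k
  by_cases h6 : n = 6
  · subst h6
    exact KYCellsLT2.kyRank_paddedPerFour_le_detSix p k
  · exact kyRank_paddedPerPoly_four_le n (by omega) p k

end Summit.PneNP.GCT
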